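import Literature.NumberTheory.LFunctions.ChebyshevHalfLineBiasCharactersProofs
import Mathlib.Analysis.SpecialFunctions.Gaussian.GaussianIntegral
import HarnessLib

/-!
# GRH-IMPLYING criteria (Suzuki 2025, Thm 8, second half: (4.2) ⟹ GRH and (4.2') ⟹ GRH), PROVED for every non-principal `χ` — «nothing here bears on the truth of RH»

LINE 1 — LABEL: RH-FREE literature (kernel proofs of GRH-IMPLYING criteria: «the Riesz mean `S_χ(x)` converges» ⟹
GRH for `L(s, χ)`; «`S_χ(x)/log x` converges» ⟹ GRH for `L(s, χ)`). bears_on: LADDER-RH COLUMN 1 SCREW (S-C, criterion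
rung). WHAT THIS IS NOT: not a route, not progress toward RH or GRH — an implication «limit statement ⟹ GRH» says which
analytic statements are AT LEAST AS STRONG as GRH; nobody has proved any such limit statement; nothing here bears on the
truth of RH.

M. Suzuki, *On variants of Chebyshev's conjecture*, Ramanujan J. **68** (2025), no. 4, art. 95 = arXiv:2411.07436
[`Suzuki2025Chebyshev`; PUBLISHED, refereed], §4.1, **Theorem 8, second half**, AS PRINTED: «the GRH for `L(s, χ)` holds
if and only if `Σ_{n ≤ x} Λ(n)χ(n)/√n (1 − log n/log x)` (4.2) converges as `x → ∞`. In this case the limit is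
`−(L'/L)(1/2, χ)` … Furthermore … the GRH for `L(s, χ)` holds if and only if
`(1/log x) Σ_{n ≤ x} Λ(n)χ(n)/√n (1 − log n/log x) → −m/2` (4.2')», typed (three clauses) as the named fact
`Suzuki2025Chebyshev_thm8_limits` (`ChebyshevHalfLineBiasCharacters.lean`). THIS FILE proves the two «⟹ GRH» halves,
for EVERY non-principal `χ` mod `q` (no primitivity, no `L(½, χ) ≠ 0`) and for EVERY limit value:
`DirichletHalfLineRiesz.riemannHypothesis_of_tendsto_rieszMean` ((4.2) ⟹ GRH) and
`DirichletHalfLineRiesz.riemannHypothesis_of_tendsto_rieszMean_div_log` ((4.2') ⟹ GRH). It does NOT discharge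
`Suzuki2025Chebyshev_thm8_limits` (still open in the tree: clause (a) «GRH ⟹ (4.2)» for imprimitive `χ` — the primitive
case is `HalfLineRiesz.tendsto_rieszMean_of_GRH`, `ChebyshevHalfLineBiasCharExplicitFormula.lean` —, clause (b), the
sign conclusion, which needs `Re(L'/L)(½, χ) ≠ 0`, (4.6), and clause (c) «GRH ⟹ (4.2')», the order-`m` explicit
formula). Theorems only: no definitions, no named facts (D-0014/D-0026).

## The printed proof and this formalisation

Printed (§4.1, after (4.5')): «Conversely, assuming (4.2) (resp. (4.2')), we have `f_χ(x) ≪ log x` (resp. `≪ (log x)²`)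
as `x → ∞`. Therefore, the integral on the left-hand side of (4.4) converges uniformly on any compact subset in
`Re(s) > 1/2`. Thus, it defines an analytic function in `Re(s) > 1/2`, and hence, `L(s)` has no zeros (or poles) in
`Re(s) > 1/2`, that is the GRH for `L(s)`.» Here, with `G_χ(t) = Re f_χ(e^t) = Σ_{n ≤ e^t} Λ(n) Re χ(n)/√n (t − log n)`
and the entire function `Z₀ = L(·, χ)L(·, χ̄)` (the device of the tree's `Suzuki2025Chebyshev_thm8_sign_holds`, whose
transform computation `∫_0^∞ G_χ(t)e^{−St} dt = −½ (Z₀'/Z₀)(½ + S)/S²`, `Re S > 1`, is repeated verbatim):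

* §2 `entire_ne_zero_of_laplace_eq_of_integrable` — the continuation step WITHOUT a sign: if `G(t)e^{−σt} ∈ L¹(0, ∞)`
  for every `σ > 0`, the transform `F` is holomorphic on `Re S > 0` (the tree's
  `Landau.differentiableOn_mellinIoi_of_forall`, Montgomery–Vaughan Lemma 15.1, after `x = e^t`), the identity
  `(F(S)S² − P(S))·Z₀(½+S) = c(S)·Z₀'(½+S)` persists from `Re S > 1` to `Re S > 0` by the identity theorem, and at a zero
  `½ + S₀` of `Z₀` with `0 < Re S₀ < ½` the analytic orders of the two sides differ by one — contradiction (the order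
  comparison of the tree's `DirichletHalfLineLandau.entire_ne_zero_of_laplace_eq`, Landau's lemma replaced by absolute
  convergence); zeros with `Re s ≥ 1` are excluded by Mathlib's `DirichletCharacter.LFunction_ne_zero_of_one_le_re`;
* §3 `lfunction_ne_zero_of_integrable_re` (the application to `Z₀`, `c ≡ −½`, `P ≡ 0`),
  `integrable_reWeighted_of_abs_le` (`|G_χ(t)| ≤ C(1 + t²)` for large `t` ⟹ the integrability, majorant
  `(K₀ + C(1+t²))e^{−σt}`), `riemannHypothesis_of_norm_rieszMean_le` (`‖S_χ(x)‖ ≤ C log x` ⟹ GRH, using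
  `G_χ(t) = t · Re S_χ(e^t)` and the tree's `DirichletHalfLineLandau.riemannHypothesis_of_forall_ne_zero` to pass from
  «no zeros on `Re s > ½`» to the strip form `DirichletCharacter.RiemannHypothesis`);
* §4 the two typed left-hand sides: a convergent `S_χ` is `O(1) ⊂ O(log x)`; a convergent `S_χ/log x` is `O(log x)`.

## References
* [Suzuki2025Chebyshev] M. Suzuki, Ramanujan J. 68 (2025) 95 = arXiv:2411.07436: §4.1 Thm 8, (4.2), (4.2'), (4.3),
  (4.4), and the paragraph «Conversely, assuming (4.2) …» of its proof.
* [MontgomeryVaughan2007] H. L. Montgomery, R. C. Vaughan, *Multiplicative Number Theory I*, CUP 2007, §15.1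
  Lemma 15.1 (holomorphy of absolutely convergent Mellin transforms) — the tree's `LandauOscillation.lean`.
-/

noncomputable section

open Complex Filter Topology Set MeasureTheory ArithmeticFunction
open scoped Real LSeries.notation ComplexConjugate

namespace Literature.NumberTheory.LFunctions

namespace DirichletHalfLineRiesz

open ZetaScrewLandau

variable {q : ℕ} [NeZero q] {χ : DirichletCharacter ℂ q}

/-! ## §1 Transform plumbing (`x = e^t`) -/

/-- `∫_1^∞ G(log x) x^{-(s+1)} dx = ∫_0^∞ G(t) e^{-st} dt`. [folklore] -/
private theorem mellinIoi_comp_log (G : ℝ → ℝ) (s : ℂ) :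
    Landau.mellinIoi (fun x ↦ G (Real.log x)) s = ∫ t in Ioi (0 : ℝ), (G t : ℂ) * cexp (-s * t) := by
  unfold Landau.mellinIoi
  rw [integral_Ioi_one_eq_integral_Ioi_zero]
  refine setIntegral_congr_fun measurableSet_Ioi fun t _ ↦ ?_
  dsimp only
  rw [Real.log_exp, ofReal_exp_cpow, Complex.real_smul, Complex.ofReal_exp]
  have : cexp (t : ℂ) * cexp ((t : ℂ) * -(s + 1)) = cexp (-s * t) := by
    rw [← Complex.exp_add]
    congr 1
    ring
  rw [← this]
  ring

/-- `G(log x) x^{-(σ+1)} ∈ L¹(1,∞)` iff `G(t) e^{-σt} ∈ L¹(0,∞)`. [folklore] -/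
private theorem integrableOn_comp_log_iff (G : ℝ → ℝ) (σ : ℝ) :
    IntegrableOn (fun x : ℝ ↦ G (Real.log x) * x ^ (-(σ + 1))) (Ioi 1) ↔
      IntegrableOn (fun t : ℝ ↦ G t * Real.exp (-σ * t)) (Ioi 0) := by
  rw [integrableOn_Ioi_one_iff]
  refine integrableOn_congr_fun (fun t _ ↦ ?_) measurableSet_Ioi
  rw [smul_eq_mul, Real.log_exp, Real.rpow_def_of_pos (Real.exp_pos t), Real.log_exp]
  have : Real.exp t * Real.exp (t * -(σ + 1)) = Real.exp (-σ * t) := by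
    rw [← Real.exp_add]
    congr 1
    ring
  rw [← this]
  ring

/-! ## §2 The continuation argument without a sign: absolute convergence on `Re S > 0` -/

/-- **Zero-freeness from an absolutely convergent transform** (the «conversely» half of the printed proofs of Thms 8/6:
«`f_χ(x) ≪ log x` … the integral converges uniformly on any compact subset in `Re(s) > 1/2` … defines an analytic function …
hence `L(s)` has no zeros in `Re(s) > 1/2`»). Let `Z₀` be entire with no zeros on `Re s ≥ 1`, `G : ℝ → ℝ` measurable with
`G(t)e^{−σt} ∈ L¹(0, ∞)` for EVERY `σ > 0`, and for `Re S > 1`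
`∫_0^∞ G e^{−St} dt = (c(S)·(Z₀'/Z₀)(½+S) + P(S))/S²` with `c`, `P` holomorphic on `Re S > 0`, `c ≠ 0` on `0 < Re S < ½`.
Then `Z₀(s) ≠ 0` for `Re s > ½` (the transform is holomorphic on `Re S > 0`; order comparison at a zero, as in the tree's
`DirichletHalfLineLandau.entire_ne_zero_of_laplace_eq`, with Landau's lemma replaced by absolute convergence).
[cite: Suzuki2025Chebyshev, §4.1 Thm 8 (proof, «Conversely, assuming (4.2) …»)] -/
theorem entire_ne_zero_of_laplace_eq_of_integrable {Z₀ : ℂ → ℂ} (hd : Differentiable ℂ Z₀)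
    (hright : ∀ s : ℂ, 1 ≤ s.re → Z₀ s ≠ 0)
    {G : ℝ → ℝ} (hG : Measurable G)
    (hint : ∀ σ : ℝ, 0 < σ → IntegrableOn (fun t : ℝ ↦ G t * Real.exp (-σ * t)) (Ioi 0))
    {c P : ℂ → ℂ} (hc : DifferentiableOn ℂ c {s : ℂ | 0 < s.re})
    (hc0 : ∀ s : ℂ, 0 < s.re → s.re < 1 / 2 → c s ≠ 0)
    (hP : DifferentiableOn ℂ P {s : ℂ | 0 < s.re})
    (htr : ∀ s : ℂ, 1 < s.re → ∫ t in Ioi (0 : ℝ), (G t : ℂ) * cexp (-s * t) =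
      (c s * logDeriv Z₀ (1 / 2 + s) + P s) / s ^ 2) :
    ∀ s : ℂ, 1 / 2 < s.re → Z₀ s ≠ 0 := by
  intro w hw hLw
  rcases le_or_gt 1 w.re with h1 | h1
  · exact hright w h1 hLw
  have hZright : ∀ s : ℂ, 1 / 2 ≤ s.re → Z₀ (1 / 2 + s) ≠ 0 := fun s hs ↦
    hright _ (by simp; linarith)
  set w₀ : ℂ := w - 1 / 2 with hw₀_def
  have hw₀ : 0 < w₀.re := by simp [hw₀_def]; linarith
  have hw₀' : w₀.re < 1 / 2 := by simp [hw₀_def]; linarith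
  have hzero : Z₀ (1 / 2 + w₀) = 0 := by
    rw [show (1 / 2 : ℂ) + w₀ = w by rw [hw₀_def]; ring]
    exact hLw
  set g : ℝ → ℝ := fun x ↦ G (Real.log x) with hg_def
  have hg : Measurable g := hG.comp Real.measurable_log
  set R : ℂ → ℂ := fun s ↦ (c s * logDeriv Z₀ (1 / 2 + s) + P s) / s ^ 2 with hR_def
  set ε : ℝ := w₀.re / 2 with hε_def
  have hε : 0 < ε := by rw [hε_def]; linarith
  have hεw : ε < w₀.re := by rw [hε_def]; linarith
  have hopen₀ : IsOpen {s : ℂ | 0 < s.re} := isOpen_lt continuous_const Complex.continuous_re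
  -- absolute convergence for every `σ > ε`, holomorphy of `F` on `Re s > ε`
  have hS : ∀ σ' : ℝ, ε < σ' → IntegrableOn (fun x ↦ g x * x ^ (-(σ' + 1))) (Ioi 1) := by
    intro σ' hσ'
    show IntegrableOn (fun x ↦ G (Real.log x) * x ^ (-(σ' + 1))) (Ioi 1)
    rw [integrableOn_comp_log_iff]
    exact hint σ' (by linarith)
  have hagree : EqOn R (Landau.mellinIoi g) {s : ℂ | 1 < s.re} := by
    intro s hs
    simp only [Set.mem_setOf_eq] at hs
    show R s = Landau.mellinIoi (fun x ↦ G (Real.log x)) s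
    rw [mellinIoi_comp_log, htr s hs]
  set F : ℂ → ℂ := Landau.mellinIoi g with hF_def
  have hFdiff : DifferentiableOn ℂ F {s : ℂ | ε < s.re} :=
    Landau.differentiableOn_mellinIoi_of_forall hg hS
  set H : Set ℂ := {s : ℂ | ε < s.re} with hH_def
  have hHo : IsOpen H := isOpen_lt continuous_const Complex.continuous_re
  have hHpre : IsPreconnected H := (convex_halfSpace_re_gt ε).isPreconnected
  have hH₀ : H ⊆ {s : ℂ | 0 < s.re} := fun s hs ↦ by
    simp only [hH_def, Set.mem_setOf_eq] at hs ⊢; linarith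
  -- the identity `(F(s) s² − P(s)) Z(s) = c(s) Z'(s)` on `H`, `Z(s) = Z₀(1/2 + s)`
  set Z : ℂ → ℂ := fun s ↦ Z₀ (1 / 2 + s) with hZ_def
  have hZd : Differentiable ℂ Z := hd.comp (by fun_prop)
  have hZa : ∀ s, AnalyticAt ℂ Z s := fun s ↦ hZd.analyticAt s
  have hderivZ : ∀ s, deriv Z s = deriv Z₀ (1 / 2 + s) := fun s ↦ by
    simp only [hZ_def]
    exact deriv_comp_const_add Z₀ (1 / 2) s
  have hca : ∀ s ∈ H, AnalyticAt ℂ c s := fun s hs ↦ hc.analyticAt (hopen₀.mem_nhds (hH₀ hs))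
  set G₁ : ℂ → ℂ := fun s ↦ F s * s ^ 2 - P s with hG₁_def
  have hGa : ∀ s ∈ H, AnalyticAt ℂ G₁ s := fun s hs ↦
    (((hFdiff.analyticOnNhd hHo) s hs).mul (analyticAt_id.pow 2)).sub
      (hP.analyticAt (hopen₀.mem_nhds (hH₀ hs)))
  have hf₁ : AnalyticOnNhd ℂ (G₁ * Z) H := fun s hs ↦ (hGa s hs).mul (hZa s)
  have hf₂ : AnalyticOnNhd ℂ (c * deriv Z) H := fun s hs ↦ (hca s hs).mul (hZa s).deriv
  have h2H : (2 : ℂ) ∈ H := by simp [hH_def]; linarith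
  have hev2 : (G₁ * Z) =ᶠ[𝓝 (2 : ℂ)] c * deriv Z := by
    have hopen : IsOpen {s : ℂ | 1 < s.re} := isOpen_lt continuous_const Complex.continuous_re
    filter_upwards [hopen.mem_nhds (show (2 : ℂ) ∈ {s : ℂ | 1 < s.re} by simp)] with s hs
    have hs' : 1 < s.re := hs
    have hL : Z₀ (1 / 2 + s) ≠ 0 := hZright s (by linarith)
    have hs0 : s ≠ 0 := fun h ↦ by rw [h, zero_re] at hs'; linarith
    rw [Pi.mul_apply, Pi.mul_apply, hderivZ s]
    simp only [hG₁_def, hZ_def]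
    rw [← hagree hs]
    simp only [hR_def]
    rw [logDeriv_apply]
    set A : ℂ := deriv Z₀ (1 / 2 + s)
    set B : ℂ := Z₀ (1 / 2 + s)
    field_simp
    ring
  have hEqOn : EqOn (G₁ * Z) (c * deriv Z) H :=
    hf₁.eqOn_of_preconnected_of_eventuallyEq hf₂ hHpre h2H hev2
  -- orders at `w₀`
  have hw₀H : w₀ ∈ H := by simp only [hH_def, Set.mem_setOf_eq]; exact hεw
  have hev : c * deriv Z =ᶠ[𝓝 w₀] G₁ * Z := by
    filter_upwards [hHo.mem_nhds hw₀H] with s hs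
    exact (hEqOn hs).symm
  have hZ0 : Z w₀ = 0 := hzero
  have hc_ord : analyticOrderAt c w₀ = 0 :=
    (hca w₀ hw₀H).analyticOrderAt_eq_zero.2 (hc0 w₀ hw₀ hw₀')
  have h1 : analyticOrderAt (deriv Z) w₀ + 1 = analyticOrderAt Z w₀ := by
    have := (hZa w₀).analyticOrderAt_deriv_add_one
    simpa [hZ0] using this
  have h2 : analyticOrderAt (c * deriv Z) w₀ = analyticOrderAt G₁ w₀ + analyticOrderAt Z w₀ := by
    rw [analyticOrderAt_congr hev, analyticOrderAt_mul (hGa w₀ hw₀H) (hZa w₀)]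
  have h3 : analyticOrderAt (c * deriv Z) w₀ = analyticOrderAt (deriv Z) w₀ := by
    rw [analyticOrderAt_mul (hca w₀ hw₀H) (hZa w₀).deriv, hc_ord, zero_add]
  rw [h3] at h2
  rw [h2] at h1
  generalize hoZ : analyticOrderAt Z w₀ = oZ at h1
  generalize hoG : analyticOrderAt G₁ w₀ = oG at h1
  cases oZ with
  | top =>
    have hloc : ∀ᶠ s in 𝓝 w₀, Z s = 0 := analyticOrderAt_eq_top.1 hoZ
    have hall : EqOn Z 0 univ :=
      (hZd.differentiableOn.analyticOnNhd isOpen_univ).eqOn_zero_of_preconnected_of_eventuallyEq_zero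
        isPreconnected_univ (Set.mem_univ w₀) hloc
    have h1' : Z 1 = 0 := hall (Set.mem_univ _)
    exact hZright 1 (by norm_num) h1'
  | coe n =>
    cases oG with
    | top => simp at h1
    | coe m =>
      have h' : (m + n + 1 : ℕ) = n := by exact_mod_cast h1
      omega

/-! ## §3 `Z₀ = L(·, χ)L(·, χ̄)`, `G(t) = Re f_χ(e^t) = Σ_{n ≤ e^t} Λ(n) Re χ(n)/√n (t − log n)` -/

/-- `A_d(t) = Σ_{n ≤ e^t} d(n)/√n` is monotone for `d ≥ 0`. [folklore] -/
private theorem monotone_count {d : ℕ → ℝ} (hd0 : ∀ n, 0 ≤ d n) :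
    Monotone fun t : ℝ ↦ ∑ n ∈ Finset.Icc 1 ⌊Real.exp t⌋₊, d n / Real.sqrt n := by
  intro t u htu
  refine Finset.sum_le_sum_of_subset_of_nonneg
    (Finset.Icc_subset_Icc_right (Nat.floor_mono (Real.exp_le_exp.2 htu))) fun n _ _ ↦ ?_
  exact div_nonneg (hd0 n) (Real.sqrt_nonneg _)

/-- `B_d(t) = Σ_{n ≤ e^t} d(n) log n/√n` is monotone for `d ≥ 0`. [folklore] -/
private theorem monotone_countLog {d : ℕ → ℝ} (hd0 : ∀ n, 0 ≤ d n) :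
    Monotone fun t : ℝ ↦ ∑ n ∈ Finset.Icc 1 ⌊Real.exp t⌋₊, d n / Real.sqrt n * Real.log n := by
  intro t u htu
  refine Finset.sum_le_sum_of_subset_of_nonneg
    (Finset.Icc_subset_Icc_right (Nat.floor_mono (Real.exp_le_exp.2 htu))) fun n _ _ ↦ ?_
  exact mul_nonneg (div_nonneg (hd0 n) (Real.sqrt_nonneg _)) (Real.log_natCast_nonneg n)

/-- `φ_d(t) = Σ_{n ≤ e^t} d(n)/√n (t − log n) = t A_d(t) − B_d(t)` is measurable. [folklore] -/
private theorem measurable_weighted {d : ℕ → ℝ} (hd0 : ∀ n, 0 ≤ d n) :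
    Measurable fun t : ℝ ↦ ∑ n ∈ Finset.Icc 1 ⌊Real.exp t⌋₊, d n / Real.sqrt n * (t - Real.log n) := by
  have h : (fun t : ℝ ↦ ∑ n ∈ Finset.Icc 1 ⌊Real.exp t⌋₊, d n / Real.sqrt n * (t - Real.log n)) =
      fun t ↦ t * (∑ n ∈ Finset.Icc 1 ⌊Real.exp t⌋₊, d n / Real.sqrt n)
        - ∑ n ∈ Finset.Icc 1 ⌊Real.exp t⌋₊, d n / Real.sqrt n * Real.log n := by
    funext t
    rw [Finset.mul_sum, ← Finset.sum_sub_distrib]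
    refine Finset.sum_congr rfl fun n _ ↦ ?_
    ring
  rw [h]
  exact (measurable_id.mul (monotone_count hd0).measurable).sub (monotone_countLog hd0).measurable

omit [NeZero q] in
/-- `|Re χ(n)| ≤ 1`. [folklore] -/
private theorem abs_re_le_one (χ : DirichletCharacter ℂ q) (a : ZMod q) : |(χ a).re| ≤ 1 :=
  (Complex.abs_re_le_norm _).trans (χ.norm_le_one a)

/-- For `‖f‖ ≤ Λ` pointwise and `Re s > 1`: `L(f, s)` converges absolutely. [folklore] -/
private theorem lseriesSummable_of_norm_le {f : ℕ → ℂ} (hf : ∀ n, ‖f n‖ ≤ Λ n) {s : ℂ} (hs : 1 < s.re) :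
    LSeriesSummable f s := by
  refine Summable.of_norm_bounded (LSeriesSummable_vonMangoldt hs).norm fun n ↦ ?_
  refine LSeries.norm_term_le s ?_
  rw [Complex.norm_real, Real.norm_of_nonneg vonMangoldt_nonneg]
  exact hf n

omit [NeZero q] in
/-- `Λ(n) Re χ(n) = (χ(n)Λ(n) + χ̄(n)Λ(n))/2` in `ℂ` (`χ̄ = χ⁻¹` pointwise). [folklore] -/
private theorem vonMangoldt_mul_re_eq (χ : DirichletCharacter ℂ q) (n : ℕ) :
    ((Λ n * (χ (n : ZMod q)).re : ℝ) : ℂ) =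
      (χ (n : ZMod q) * (Λ n : ℂ) + χ⁻¹ (n : ZMod q) * (Λ n : ℂ)) / 2 := by
  rw [← MulChar.star_apply', Complex.star_def, ← add_mul]
  push_cast
  rw [Complex.re_eq_add_conj]
  ring

omit [NeZero q] in
/-- `Σ_{n ≤ e^t} Λ(n) Re χ(n)/√n (t − log n) = φ_{d⁺}(t) − φ_{d⁻}(t)` with `d^± = Λ · (±Re χ)₊`. [folklore] -/
private theorem reWeighted_eq_sub (χ : DirichletCharacter ℂ q) (t : ℝ) :
    ∑ n ∈ Finset.Icc 1 ⌊Real.exp t⌋₊, Λ n * (χ (n : ZMod q)).re / Real.sqrt n * (t - Real.log n) =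
      (∑ n ∈ Finset.Icc 1 ⌊Real.exp t⌋₊,
          Λ n * max (χ (n : ZMod q)).re 0 / Real.sqrt n * (t - Real.log n))
        - ∑ n ∈ Finset.Icc 1 ⌊Real.exp t⌋₊,
          Λ n * max (-(χ (n : ZMod q)).re) 0 / Real.sqrt n * (t - Real.log n) := by
  rw [← Finset.sum_sub_distrib]
  refine Finset.sum_congr rfl fun n _ ↦ ?_
  have := max_zero_sub_max_neg_zero_eq_self (χ (n : ZMod q)).re
  rw [← sub_mul, ← sub_div, ← mul_sub, this]

omit [NeZero q] in
/-- `t ↦ Σ_{n ≤ e^t} Λ(n) Re χ(n)/√n (t − log n)` is measurable. [folklore] -/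
private theorem measurable_reWeighted (χ : DirichletCharacter ℂ q) :
    Measurable fun t : ℝ ↦
      ∑ n ∈ Finset.Icc 1 ⌊Real.exp t⌋₊, Λ n * (χ (n : ZMod q)).re / Real.sqrt n * (t - Real.log n) := by
  have h : (fun t : ℝ ↦
      ∑ n ∈ Finset.Icc 1 ⌊Real.exp t⌋₊, Λ n * (χ (n : ZMod q)).re / Real.sqrt n * (t - Real.log n)) =
      fun t ↦ (∑ n ∈ Finset.Icc 1 ⌊Real.exp t⌋₊,
          Λ n * max (χ (n : ZMod q)).re 0 / Real.sqrt n * (t - Real.log n))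
        - ∑ n ∈ Finset.Icc 1 ⌊Real.exp t⌋₊,
          Λ n * max (-(χ (n : ZMod q)).re) 0 / Real.sqrt n * (t - Real.log n) :=
    funext (reWeighted_eq_sub χ)
  rw [h]
  exact (measurable_weighted (d := fun n ↦ Λ n * max (χ (n : ZMod q)).re 0)
      fun n ↦ mul_nonneg vonMangoldt_nonneg (le_max_right _ _)).sub
    (measurable_weighted (d := fun n ↦ Λ n * max (-(χ (n : ZMod q)).re) 0)
      fun n ↦ mul_nonneg vonMangoldt_nonneg (le_max_right _ _))

/-- **Zero-freeness of `L(s, χ)` on `Re s > ½` from absolute convergence.** For a non-principal `χ` mod `q`: if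
`G_χ(t) = Σ_{n ≤ e^t} Λ(n) Re χ(n)/√n (t − log n)` (`= Re f_χ(e^t)`, `f_χ` of (4.3)) has `G_χ(t) e^{−σt} ∈ L¹(0, ∞)` for every
`σ > 0`, then `L(s, χ) ≠ 0` for `Re s > ½`. With `Z₀ = L(·, χ)L(·, χ̄)` (entire) the transform of `G_χ` is
`−½ (Z₀'/Z₀)(½ + S)/S²` for `Re S > 1` (the computation of the tree's `Suzuki2025Chebyshev_thm8_sign_holds`:
`Σ Λ(n) Re χ(n) n^{−w} = −½[(L'/L)(w, χ) + (L'/L)(w, χ̄)]`); `entire_ne_zero_of_laplace_eq_of_integrable` concludes.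
[cite: Suzuki2025Chebyshev, §4.1 Thm 8 (proof, converse direction) with (4.4)] -/
theorem lfunction_ne_zero_of_integrable_re (hχ : χ ≠ 1)
    (hint : ∀ σ : ℝ, 0 < σ → IntegrableOn (fun t : ℝ ↦
      (∑ n ∈ Finset.Icc 1 ⌊Real.exp t⌋₊, Λ n * (χ (n : ZMod q)).re / Real.sqrt n * (t - Real.log n)) *
        Real.exp (-σ * t)) (Ioi 0)) :
    ∀ s : ℂ, 1 / 2 < s.re → χ.LFunction s ≠ 0 := by
  have hχ' : χ⁻¹ ≠ 1 := inv_ne_one.mpr hχ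
  -- the coefficients `d⁺ = Λ · (Re χ)₊`, `d⁻ = Λ · (−Re χ)₊`, both in `[0, Λ]`
  set dp : ℕ → ℝ := fun n ↦ Λ n * max (χ (n : ZMod q)).re 0 with hdp
  set dm : ℕ → ℝ := fun n ↦ Λ n * max (-(χ (n : ZMod q)).re) 0 with hdm
  set g : ℕ → ℂ := fun n ↦ ((Λ n * (χ (n : ZMod q)).re : ℝ) : ℂ) with hg
  have hre1 : ∀ n : ℕ, |(χ (n : ZMod q)).re| ≤ 1 := fun n ↦ abs_re_le_one χ _
  have hdp0 : ∀ n, 0 ≤ dp n := fun n ↦ mul_nonneg vonMangoldt_nonneg (le_max_right _ _)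
  have hdm0 : ∀ n, 0 ≤ dm n := fun n ↦ mul_nonneg vonMangoldt_nonneg (le_max_right _ _)
  have hdple : ∀ n, dp n ≤ Λ n := fun n ↦ by
    have h1 : max (χ (n : ZMod q)).re 0 ≤ 1 := max_le (le_trans (le_abs_self _) (hre1 n)) zero_le_one
    exact mul_le_of_le_one_right vonMangoldt_nonneg h1
  have hdmle : ∀ n, dm n ≤ Λ n := fun n ↦ by
    have h1 : max (-(χ (n : ZMod q)).re) 0 ≤ 1 := max_le (le_trans (neg_le_abs _) (hre1 n)) zero_le_one
    exact mul_le_of_le_one_right vonMangoldt_nonneg h1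
  have hdiff : ∀ n : ℕ, dp n - dm n = Λ n * (χ (n : ZMod q)).re := by
    intro n
    simp only [hdp, hdm]
    have := max_zero_sub_max_neg_zero_eq_self (χ (n : ZMod q)).re
    linear_combination (Λ n) * this
  -- `Z₀ = L(·, χ) L(·, χ̄)`: entire, zero-free on `Re s ≥ 1`
  set Z₀ : ℂ → ℂ := fun s ↦ χ.LFunction s * χ⁻¹.LFunction s with hZ₀_def
  have hdχ := DirichletCharacter.differentiable_LFunction hχ
  have hdχ' := DirichletCharacter.differentiable_LFunction hχ'
  have hZ₀d : Differentiable ℂ Z₀ := hdχ.mul hdχ'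
  have hZ₀right : ∀ s : ℂ, 1 ≤ s.re → Z₀ s ≠ 0 := fun s hs ↦
    mul_ne_zero (DirichletCharacter.LFunction_ne_zero_of_one_le_re χ (Or.inl hχ) hs)
      (DirichletCharacter.LFunction_ne_zero_of_one_le_re χ⁻¹ (Or.inl hχ') hs)
  -- the function `G_χ`
  set G : ℝ → ℝ := fun t ↦
    ∑ n ∈ Finset.Icc 1 ⌊Real.exp t⌋₊, Λ n * (χ (n : ZMod q)).re / Real.sqrt n * (t - Real.log n) with hG_def
  have hGeq : ∀ t, G t = (∑ n ∈ Finset.Icc 1 ⌊Real.exp t⌋₊, dp n / Real.sqrt n * (t - Real.log n))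
      - ∑ n ∈ Finset.Icc 1 ⌊Real.exp t⌋₊, dm n / Real.sqrt n * (t - Real.log n) := fun t ↦
    reWeighted_eq_sub χ t
  have hGm : Measurable G := measurable_reWeighted χ
  have hZ : ∀ s : ℂ, 1 / 2 < s.re → Z₀ s ≠ 0 := by
    refine entire_ne_zero_of_laplace_eq_of_integrable hZ₀d hZ₀right hGm hint
      (c := fun _ ↦ -(1 / 2 : ℂ)) (P := fun _ ↦ 0) (by fun_prop) (fun _ _ _ ↦ by norm_num) (by fun_prop)
      (fun s hs ↦ ?_)
    -- the transform for `Re S > 1`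
    have ha : (-s).re < -1 / 2 := by simp; linarith
    obtain ⟨hi₁, hI₁⟩ := HalfLinePrimeOnlyLandau.integral_weighted_mul_cexp (d := dp) hdp0 hdple ha
    obtain ⟨hi₂, hI₂⟩ := HalfLinePrimeOnlyLandau.integral_weighted_mul_cexp (d := dm) hdm0 hdmle ha
    have heq : EqOn (fun t : ℝ ↦ (G t : ℂ) * cexp (-s * t))
        (fun t ↦
          (((∑ n ∈ Finset.Icc 1 ⌊Real.exp t⌋₊, dp n / Real.sqrt n * (t - Real.log n) : ℝ) : ℂ) *
              cexp (-s * t)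
            - ((∑ n ∈ Finset.Icc 1 ⌊Real.exp t⌋₊, dm n / Real.sqrt n * (t - Real.log n) : ℝ) : ℂ) *
              cexp (-s * t))) (Ioi 0) := by
      intro t _
      simp only [hGeq t]
      push_cast
      ring
    rw [setIntegral_congr_fun measurableSet_Ioi heq, integral_sub hi₁ hi₂, hI₁, hI₂,
      show (1 / 2 : ℂ) - -s = 1 / 2 + s by ring]
    set w : ℂ := 1 / 2 + s with hw_def
    have hw : 1 < w.re := by simp [hw_def]; linarith
    -- summability of the series at `w`
    have hSp : LSeriesSummable (fun n ↦ (dp n : ℂ)) w :=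
      lseriesSummable_of_norm_le (fun n ↦ by
        rw [Complex.norm_real, Real.norm_of_nonneg (hdp0 n)]; exact hdple n) hw
    have hSm : LSeriesSummable (fun n ↦ (dm n : ℂ)) w :=
      lseriesSummable_of_norm_le (fun n ↦ by
        rw [Complex.norm_real, Real.norm_of_nonneg (hdm0 n)]; exact hdmle n) hw
    have hSg : LSeriesSummable g w :=
      lseriesSummable_of_norm_le (fun n ↦ by
        simp only [hg]
        rw [Complex.norm_real, Real.norm_eq_abs, abs_mul, abs_of_nonneg vonMangoldt_nonneg]
        exact mul_le_of_le_one_right vonMangoldt_nonneg (hre1 n)) hw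
    have hSχ : LSeriesSummable (↗χ * ↗Λ) w := DirichletCharacter.LSeriesSummable_twist_vonMangoldt χ hw
    have hSχ' : LSeriesSummable (↗χ⁻¹ * ↗Λ) w := DirichletCharacter.LSeriesSummable_twist_vonMangoldt χ⁻¹ hw
    -- `L(d⁺) − L(d⁻) = L(Λ Re χ)` and `L(χΛ) + L(χ̄Λ) = 2 L(Λ Re χ)`
    have hA : L (fun n ↦ (dp n : ℂ)) w - L (fun n ↦ (dm n : ℂ)) w = L g w := by
      rw [← LSeries_sub hSp hSm]
      congr 1
      funext n
      simp only [Pi.sub_apply, hg]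
      rw [← hdiff n]
      push_cast
      ring
    have hsum : L (↗χ * ↗Λ) w + L (↗χ⁻¹ * ↗Λ) w = 2 * L g w := by
      rw [← LSeries_add hSχ hSχ', two_mul, ← LSeries_add hSg hSg]
      congr 1
      funext n
      simp only [Pi.add_apply, Pi.mul_apply, hg]
      rw [vonMangoldt_mul_re_eq χ n]
      ring
    -- `L(χΛ, w) = −(L'/L)(w, χ)`, the same for `χ̄`, and `(Z₀'/Z₀) = (L'/L)(·, χ) + (L'/L)(·, χ̄)`
    have hB : L (↗χ * ↗Λ) w = -logDeriv χ.LFunction w := by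
      rw [DirichletCharacter.LSeries_twist_vonMangoldt_eq χ hw, logDeriv_apply,
        DirichletCharacter.LFunction_eq_LSeries χ hw, DirichletCharacter.deriv_LFunction_eq_deriv_LSeries χ hw,
        neg_div]
    have hB' : L (↗χ⁻¹ * ↗Λ) w = -logDeriv χ⁻¹.LFunction w := by
      rw [DirichletCharacter.LSeries_twist_vonMangoldt_eq χ⁻¹ hw, logDeriv_apply,
        DirichletCharacter.LFunction_eq_LSeries χ⁻¹ hw,
        DirichletCharacter.deriv_LFunction_eq_deriv_LSeries χ⁻¹ hw, neg_div]
    have hZlog : logDeriv Z₀ w = logDeriv χ.LFunction w + logDeriv χ⁻¹.LFunction w :=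
      logDeriv_mul (f := χ.LFunction) (g := χ⁻¹.LFunction) w
        (DirichletCharacter.LFunction_ne_zero_of_one_le_re χ (Or.inl hχ) hw.le)
        (DirichletCharacter.LFunction_ne_zero_of_one_le_re χ⁻¹ (Or.inl hχ') hw.le) (hdχ w) (hdχ' w)
    have hlogg : logDeriv Z₀ w = -(2 * L g w) := by
      rw [hZlog, ← hsum, hB, hB']
      ring
    have hs0 : s ≠ 0 := fun h ↦ by rw [h, zero_re] at hs; linarith
    rw [← mul_sub, hA, hlogg]
    field_simp
    ring
  intro s hs h0
  exact hZ s hs (by simp only [hZ₀_def]; rw [h0, zero_mul])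

omit [NeZero q] in
/-- **Polynomial growth suffices.** If `|G_χ(t)| ≤ C(1 + t²)` for `t ≥ t₁`, then `G_χ(t)e^{−σt} ∈ L¹(0, ∞)` for every
`σ > 0` (`G_χ` is bounded by `t₁ ψ(e^{t₁})` on `(0, t₁]`; majorant `(K₀ + C(1+t²))e^{−σt}`).
[cite: Suzuki2025Chebyshev, §4.1 Thm 8 (proof, converse direction: «f_χ(x) ≪ log x … the integral … converges»)] -/
theorem integrable_reWeighted_of_abs_le (χ : DirichletCharacter ℂ q)
    (hbound : ∃ C t₁ : ℝ, ∀ t : ℝ, t₁ ≤ t →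
      |∑ n ∈ Finset.Icc 1 ⌊Real.exp t⌋₊, Λ n * (χ (n : ZMod q)).re / Real.sqrt n * (t - Real.log n)| ≤
        C * (1 + t ^ 2))
    {σ : ℝ} (hσ : 0 < σ) :
    IntegrableOn (fun t : ℝ ↦
      (∑ n ∈ Finset.Icc 1 ⌊Real.exp t⌋₊, Λ n * (χ (n : ZMod q)).re / Real.sqrt n * (t - Real.log n)) *
        Real.exp (-σ * t)) (Ioi 0) := by
  obtain ⟨C, t₁, hC⟩ := hbound
  set G : ℝ → ℝ := fun t ↦
    ∑ n ∈ Finset.Icc 1 ⌊Real.exp t⌋₊, Λ n * (χ (n : ZMod q)).re / Real.sqrt n * (t - Real.log n) with hG_def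
  have hre1 : ∀ n : ℕ, |(χ (n : ZMod q)).re| ≤ 1 := fun n ↦ abs_re_le_one χ _
  set T : ℝ := max t₁ 0 with hT_def
  have hT0 : 0 ≤ T := le_max_right _ _
  have hT1 : t₁ ≤ T := le_max_left _ _
  set K₀ : ℝ := T * ∑ n ∈ Finset.Icc 1 ⌊Real.exp T⌋₊, Λ n with hK₀_def
  have hK₀ : 0 ≤ K₀ := mul_nonneg hT0 (Finset.sum_nonneg fun n _ ↦ vonMangoldt_nonneg)
  have hC0 : 0 ≤ C := by
    have h := (abs_nonneg _).trans (hC T hT1)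
    by_contra hneg
    have : C * (1 + T ^ 2) < 0 := mul_neg_of_neg_of_pos (not_le.1 hneg) (by positivity)
    linarith
  -- crude bound on `(0, T]`
  have hcrude : ∀ t : ℝ, 0 < t → t ≤ T → |G t| ≤ K₀ := by
    intro t ht htT
    simp only [hG_def]
    calc |∑ n ∈ Finset.Icc 1 ⌊Real.exp t⌋₊, Λ n * (χ (n : ZMod q)).re / Real.sqrt n * (t - Real.log n)|
        ≤ ∑ n ∈ Finset.Icc 1 ⌊Real.exp t⌋₊, |Λ n * (χ (n : ZMod q)).re / Real.sqrt n * (t - Real.log n)| :=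
          Finset.abs_sum_le_sum_abs _ _
      _ ≤ ∑ n ∈ Finset.Icc 1 ⌊Real.exp t⌋₊, Λ n * t := by
          refine Finset.sum_le_sum fun n hn ↦ ?_
          rw [Finset.mem_Icc] at hn
          have hn1 : (1 : ℝ) ≤ n := by exact_mod_cast hn.1
          have hn0 : (0 : ℝ) < n := by linarith
          have hnle : (n : ℝ) ≤ Real.exp t :=
            le_trans (by exact_mod_cast hn.2) (Nat.floor_le (Real.exp_pos t).le)
          have hlog : Real.log n ≤ t := (Real.log_le_iff_le_exp hn0).2 hnle
          have hlog0 : 0 ≤ Real.log n := Real.log_nonneg hn1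
          have hsqrt1 : 1 ≤ Real.sqrt n := Real.one_le_sqrt.2 hn1
          have hsqrt0 : 0 < Real.sqrt n := by linarith
          rw [abs_mul, abs_div, abs_mul, abs_of_nonneg vonMangoldt_nonneg, abs_of_pos hsqrt0,
            abs_of_nonneg (by linarith : 0 ≤ t - Real.log n)]
          have h1 : Λ n * |(χ (n : ZMod q)).re| / Real.sqrt n ≤ Λ n := by
            rw [div_le_iff₀ hsqrt0]
            calc Λ n * |(χ (n : ZMod q)).re| ≤ Λ n * 1 :=
                  mul_le_mul_of_nonneg_left (hre1 n) vonMangoldt_nonneg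
              _ ≤ Λ n * Real.sqrt n := mul_le_mul_of_nonneg_left hsqrt1 vonMangoldt_nonneg
          exact mul_le_mul h1 (by linarith) (by linarith) vonMangoldt_nonneg
      _ ≤ ∑ n ∈ Finset.Icc 1 ⌊Real.exp T⌋₊, Λ n * t :=
          Finset.sum_le_sum_of_subset_of_nonneg
            (Finset.Icc_subset_Icc_right (Nat.floor_mono (Real.exp_le_exp.2 htT)))
            fun n _ _ ↦ mul_nonneg vonMangoldt_nonneg ht.le
      _ = t * ∑ n ∈ Finset.Icc 1 ⌊Real.exp T⌋₊, Λ n := by rw [Finset.mul_sum]; simp_rw [mul_comm]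
      _ ≤ K₀ := mul_le_mul_of_nonneg_right htT (Finset.sum_nonneg fun n _ ↦ vonMangoldt_nonneg)
  -- global bound on `(0, ∞)`
  have hglob : ∀ t : ℝ, 0 < t → |G t| ≤ K₀ + C * (1 + t ^ 2) := by
    intro t ht
    rcases le_or_gt t T with h | h
    · have := hcrude t ht h
      have : 0 ≤ C * (1 + t ^ 2) := by positivity
      linarith
    · have := hC t (by linarith)
      linarith
  -- the majorant
  have hmaj : IntegrableOn (fun t : ℝ ↦ (K₀ + C * (1 + t ^ 2)) * Real.exp (-σ * t)) (Ioi 0) := by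
    have h1 : IntegrableOn (fun t : ℝ ↦ Real.exp (-σ * t)) (Ioi 0) := exp_neg_integrableOn_Ioi 0 hσ
    have h2 : IntegrableOn (fun t : ℝ ↦ t ^ (2 : ℝ) * Real.exp (-σ * t ^ (1 : ℝ))) (Ioi 0) :=
      integrableOn_rpow_mul_exp_neg_mul_rpow (by norm_num) le_rfl hσ
    have h2' : IntegrableOn (fun t : ℝ ↦ t ^ 2 * Real.exp (-σ * t)) (Ioi 0) := by
      refine h2.congr_fun (fun t _ ↦ ?_) measurableSet_Ioi
      dsimp only
      rw [Real.rpow_one, Real.rpow_two]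
    have h3 : IntegrableOn (fun t : ℝ ↦ (K₀ + C) * Real.exp (-σ * t) + C * (t ^ 2 * Real.exp (-σ * t))) (Ioi 0) :=
      (h1.const_mul (K₀ + C)).add (h2'.const_mul C)
    refine h3.congr_fun (fun t _ ↦ ?_) measurableSet_Ioi
    ring
  have hmeas : AEStronglyMeasurable (fun t : ℝ ↦ G t * Real.exp (-σ * t)) (volume.restrict (Ioi 0)) :=
    ((measurable_reWeighted χ).mul (by fun_prop)).aestronglyMeasurable
  refine hmaj.mono' hmeas ?_
  filter_upwards [ae_restrict_mem measurableSet_Ioi] with t ht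
  rw [Real.norm_eq_abs, abs_mul, abs_of_pos (Real.exp_pos _)]
  exact mul_le_mul_of_nonneg_right (hglob t ht) (Real.exp_pos _).le

omit [NeZero q] in
/-- `G_χ(t) = t · Re S_χ(e^t)` (`t ≠ 0`), `S_χ(x) = Σ_{n ≤ x} Λ(n)χ(n)/√n (1 − log n/log x)` the Riesz mean of Thm 8.
[folklore] -/
private theorem reWeighted_eq_mul_re (χ : DirichletCharacter ℂ q) {t : ℝ} (ht : t ≠ 0) :
    ∑ n ∈ Finset.Icc 1 ⌊Real.exp t⌋₊, Λ n * (χ (n : ZMod q)).re / Real.sqrt n * (t - Real.log n) =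
      t * (∑ n ∈ Finset.Icc 1 ⌊Real.exp t⌋₊, (Λ n : ℂ) * χ (n : ZMod q) / (Real.sqrt n : ℂ) *
        ((1 - Real.log n / t : ℝ) : ℂ)).re := by
  rw [Complex.re_sum, Finset.mul_sum]
  refine Finset.sum_congr rfl fun n _ ↦ ?_
  have h1 : (Λ n : ℂ) * χ (n : ZMod q) / (Real.sqrt n : ℂ) * ((1 - Real.log n / t : ℝ) : ℂ) =
      ((Λ n / Real.sqrt n * (1 - Real.log n / t) : ℝ) : ℂ) * χ (n : ZMod q) := by
    push_cast
    ring
  rw [h1, Complex.re_ofReal_mul]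
  field_simp

/-- **`S_χ(x) = O(log x)` forces GRH** (`χ ≠ χ₀`): if the Riesz mean `S_χ(x) = Σ_{n ≤ x} Λ(n)χ(n)/√n (1 − log n/log x)`
satisfies `‖S_χ(x)‖ ≤ C log x` for `x ≥ x₁`, then `L(s, χ) ≠ 0` on `Re s > ½` and GRH holds for `L(s, χ)` (strip form, via
the tree's `DirichletHalfLineLandau.riemannHypothesis_of_forall_ne_zero`). This covers both printed hypotheses «(4.2)»
(`S_χ` convergent) and «(4.2')» (`S_χ(x)/log x` convergent).
[cite: Suzuki2025Chebyshev, §4.1 Thm 8 (proof: «Conversely, assuming (4.2) (resp. (4.2')) … f_χ(x) ≪ log x (resp. ≪ (log x)²) … the GRH for L(s)»)] -/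
theorem riemannHypothesis_of_norm_rieszMean_le (hχ : χ ≠ 1)
    (hS : ∃ C x₁ : ℝ, ∀ x : ℝ, x₁ ≤ x →
      ‖∑ n ∈ Finset.Icc 1 ⌊x⌋₊, (Λ n : ℂ) * χ (n : ZMod q) / (Real.sqrt n : ℂ) *
        ((1 - Real.log n / Real.log x : ℝ) : ℂ)‖ ≤ C * Real.log x) :
    χ.RiemannHypothesis := by
  obtain ⟨C, x₁, hC⟩ := hS
  refine DirichletHalfLineLandau.riemannHypothesis_of_forall_ne_zero hχ
    (lfunction_ne_zero_of_integrable_re hχ fun σ hσ ↦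
      integrable_reWeighted_of_abs_le χ ⟨max C 0, max x₁ 1, fun t ht ↦ ?_⟩ hσ)
  have ht1 : 1 ≤ t := le_trans (le_max_right _ _) ht
  have ht0 : t ≠ 0 := by positivity
  have hx : x₁ ≤ Real.exp t := by
    have h1 := Real.add_one_le_exp t
    have h2 := le_trans (le_max_left _ _) ht
    linarith
  have hb := hC (Real.exp t) hx
  rw [Real.log_exp] at hb
  rw [reWeighted_eq_mul_re χ ht0, abs_mul, abs_of_pos (by positivity : (0 : ℝ) < t)]
  calc t * |(∑ n ∈ Finset.Icc 1 ⌊Real.exp t⌋₊, (Λ n : ℂ) * χ (n : ZMod q) / (Real.sqrt n : ℂ) *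
          ((1 - Real.log n / t : ℝ) : ℂ)).re|
      ≤ t * ‖∑ n ∈ Finset.Icc 1 ⌊Real.exp t⌋₊, (Λ n : ℂ) * χ (n : ZMod q) / (Real.sqrt n : ℂ) *
          ((1 - Real.log n / t : ℝ) : ℂ)‖ :=
        mul_le_mul_of_nonneg_left (Complex.abs_re_le_norm _) (by positivity)
    _ ≤ t * (C * t) := mul_le_mul_of_nonneg_left hb (by positivity)
    _ = C * t ^ 2 := by ring
    _ ≤ max C 0 * t ^ 2 := mul_le_mul_of_nonneg_right (le_max_left _ _) (sq_nonneg _)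
    _ ≤ max C 0 * (1 + t ^ 2) := mul_le_mul_of_nonneg_left (by linarith) (le_max_right _ _)

/-! ## §4 The typed left-hand sides of Thm 8, clauses (4.2) and (4.2'), imply GRH — for every non-principal `χ` -/

/-- **Suzuki 2025, Thm 8, (4.2) ⟹ GRH, PROVED for every non-principal `χ` mod `q` and every limit value**: if
`Σ_{n ≤ x} Λ(n)χ(n)/√n (1 − log n/log x)` converges as `x → ∞` (to anything), then GRH holds for `L(s, χ)`. In particular the
«⟹» half of clause (a) of `Suzuki2025Chebyshev_thm8_limits` (there with the limit `−(L'/L)(½, χ)`), with no primitivity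
or `L(½, χ) ≠ 0` hypothesis. [cite: Suzuki2025Chebyshev, §4.1 Thm 8 (second half, (4.2) ⟹ GRH)] -/
theorem riemannHypothesis_of_tendsto_rieszMean (hχ : χ ≠ 1) {ℓ : ℂ}
    (h : Tendsto (fun x : ℝ ↦ ∑ n ∈ Finset.Icc 1 ⌊x⌋₊,
        (Λ n : ℂ) * χ (n : ZMod q) / (Real.sqrt n : ℂ) * ((1 - Real.log n / Real.log x : ℝ) : ℂ))
      atTop (𝓝 ℓ)) :
    χ.RiemannHypothesis := by
  refine riemannHypothesis_of_norm_rieszMean_le hχ ?_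
  obtain ⟨x₀, hx₀⟩ := Filter.eventually_atTop.1 (Metric.tendsto_nhds.1 h 1 one_pos)
  refine ⟨‖ℓ‖ + 1, max x₀ (Real.exp 1), fun x hx ↦ ?_⟩
  have hx0 : x₀ ≤ x := le_trans (le_max_left _ _) hx
  have hlog : 1 ≤ Real.log x := by
    rw [← Real.log_exp 1]
    exact Real.log_le_log (Real.exp_pos 1) (le_trans (le_max_right _ _) hx)
  have hd := hx₀ x hx0
  rw [dist_eq_norm] at hd
  set S := ∑ n ∈ Finset.Icc 1 ⌊x⌋₊,
    (Λ n : ℂ) * χ (n : ZMod q) / (Real.sqrt n : ℂ) * ((1 - Real.log n / Real.log x : ℝ) : ℂ)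
  calc ‖S‖ = ‖(S - ℓ) + ℓ‖ := by rw [sub_add_cancel]
    _ ≤ ‖S - ℓ‖ + ‖ℓ‖ := norm_add_le _ _
    _ ≤ (‖ℓ‖ + 1) * 1 := by linarith
    _ ≤ (‖ℓ‖ + 1) * Real.log x := mul_le_mul_of_nonneg_left hlog (by positivity)

/-- **Suzuki 2025, Thm 8, (4.2') ⟹ GRH, PROVED for every non-principal `χ` mod `q` and every limit value**: if
`(1/log x) Σ_{n ≤ x} Λ(n)χ(n)/√n (1 − log n/log x)` converges as `x → ∞` (to anything), then GRH holds for `L(s, χ)`. In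
particular the «⟹» half of clause (c) of `Suzuki2025Chebyshev_thm8_limits` (there with the limit `−m_χ/2`).
[cite: Suzuki2025Chebyshev, §4.1 Thm 8 (second half, (4.2') ⟹ GRH)] -/
theorem riemannHypothesis_of_tendsto_rieszMean_div_log (hχ : χ ≠ 1) {ℓ : ℂ}
    (h : Tendsto (fun x : ℝ ↦ (1 / (Real.log x : ℂ)) * ∑ n ∈ Finset.Icc 1 ⌊x⌋₊,
        (Λ n : ℂ) * χ (n : ZMod q) / (Real.sqrt n : ℂ) * ((1 - Real.log n / Real.log x : ℝ) : ℂ))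
      atTop (𝓝 ℓ)) :
    χ.RiemannHypothesis := by
  refine riemannHypothesis_of_norm_rieszMean_le hχ ?_
  obtain ⟨x₀, hx₀⟩ := Filter.eventually_atTop.1 (Metric.tendsto_nhds.1 h 1 one_pos)
  refine ⟨‖ℓ‖ + 1, max x₀ (Real.exp 1), fun x hx ↦ ?_⟩
  have hx0 : x₀ ≤ x := le_trans (le_max_left _ _) hx
  have hlog : 1 ≤ Real.log x := by
    rw [← Real.log_exp 1]
    exact Real.log_le_log (Real.exp_pos 1) (le_trans (le_max_right _ _) hx)
  have hlog0 : 0 < Real.log x := by linarith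
  have hd := hx₀ x hx0
  rw [dist_eq_norm] at hd
  set S := ∑ n ∈ Finset.Icc 1 ⌊x⌋₊,
    (Λ n : ℂ) * χ (n : ZMod q) / (Real.sqrt n : ℂ) * ((1 - Real.log n / Real.log x : ℝ) : ℂ)
  have hnorm : ‖(1 / (Real.log x : ℂ)) * S‖ = ‖S‖ / Real.log x := by
    rw [norm_mul, norm_div, norm_one, Complex.norm_real, Real.norm_of_nonneg hlog0.le]
    ring
  have h1 : ‖(1 / (Real.log x : ℂ)) * S‖ ≤ ‖ℓ‖ + 1 :=
    calc ‖(1 / (Real.log x : ℂ)) * S‖ = ‖((1 / (Real.log x : ℂ)) * S - ℓ) + ℓ‖ := by rw [sub_add_cancel]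
      _ ≤ ‖(1 / (Real.log x : ℂ)) * S - ℓ‖ + ‖ℓ‖ := norm_add_le _ _
      _ ≤ ‖ℓ‖ + 1 := by linarith
  rw [hnorm, div_le_iff₀ hlog0] at h1
  exact h1

end DirichletHalfLineRiesz

end Literature.NumberTheory.LFunctions

end
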